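import Summits.Ventures.PackingBounds.Configurations.CliqueFrame
import Summits.Ventures.PackingBounds.Configurations.DesignIdentities
import Summits.Ventures.PackingBounds.Configurations.Dim5Card16EnergyRigidity
import Summits.Ventures.PackingBounds.Configurations.Dim5Card16

/-!
# Uniqueness of the 16-point sharp configuration on `S⁴` (the `(5, 16, 1/5)` code, `D₅` half-cube / Clebsch)

Framing: lottery ticket; floor = certified bounds/negative ranges. Venture `PackingBounds` (cell
`pub-packcert`, seat `pub-packcert-energy`) — Cohn–Kumar Table 1, row `(5, 16)`, uniqueness column.

**Theorem** (`isometric`, `isometric_pts`). Any two `16`-point codes in `ℝ⁵` with pairwise inner products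
`≤ 1/5` are isometric; each is an isometric image of `Config.Dim5Card16.pts`; with
`Dim5Card16EnergyRigidity` the same holds for every `16`-point ground state of `(1+t)^k`, `k ≥ 4`
(`isometric_pts_of_ckPow_energy_eq`). In print the uniqueness is deduced from the uniqueness of the
Clebsch strongly regular graph (Cohn–Kumar, Appendix A; Godsil–Royle Thm 10.6.4); the proof here is a
different, classification-free one ("clique frame"):

1. complementary slackness for the sharp Delsarte certificate `(t + 3/5)²(t - 1/5)` puts all inner products in
   `{1/5, -3/5}` and kills the Gegenbauer moments of orders `1, 2, 3` (`inner_of_card_eq_16`,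
   `moments_of_card_eq_16`), whence `Σ_{w ∈ C} ⟪u, w⟫ = 0` for every `u` (`DesignIdentities`);
2. around any `x ∈ C` exactly five points are at `-3/5` (count read off the functional `(1 - 5⟪x,w⟫)/4`) and
   they are pairwise at `1/5` (three unit vectors cannot be pairwise at `-3/5`): a `1/5`-frame `a₁..a₅`
   (`exists_frame`), a basis of `ℝ⁵` (`CliqueFrame`);
3. every `z ∈ C` is read off its profile `(⟪z, aⱼ⟫)ⱼ ∈ {1/5, -3/5}⁵`: the norm identity forces
   `#{j : ⟪z,aⱼ⟫ = -3/5} ∈ {2, 5}` and `z = Σ_{j ∈ T} aⱼ - c σ` (`σ = Σ aⱼ`) for one of `16` index data `(T, c)`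
   (`exists_index`); by cardinality `C` is the image of this fixed family (`eq_image`);
4. the Gram matrix of the family depends on the index data only (`CliqueFrame.isometric_of_frames`).

## References
* H. Cohn, A. Kumar, J. Amer. Math. Soc. 20 (2007) 99–148, Table 1 and Appendix A. [`CohnKumar2006`]
-/

noncomputable section

namespace Summit.Ventures.PackingBounds.Config.Dim5Card16Unique

open Finset Module Literature.Analysis.SpecialFunctions Literature.Geometry.DiscreteGeometry CliqueFrame

/-! ### Complementary slackness -/

/-- The sharp certificate `(t + 3/5)²(t - 1/5)` in the Gegenbauer basis of `S⁴` (`μ = 3/2`). -/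
private theorem hpoly (t : ℝ) : ∑ k ∈ range (3 + 1),
    (fun k => match k with | 0 => 16 / 125 | 1 => 32 / 175 | 2 => 2 / 15 | 3 => 2 / 35 | _ => 0) k *
      gegenbauerSum ((3 / 2 : ℝ)) k t = (t + 3 / 5) ^ 2 * (t - 1 / 5) := by
  simp [Finset.sum_range_succ, gegenbauerSum, gegenbauerCoeff, Finset.prod_range_succ, Nat.factorial]
  ring

section config

variable {C : Finset (EuclideanSpace ℝ (Fin 5))} (h1 : ∀ x ∈ C, ‖x‖ = 1)
  (h2 : ∀ x ∈ C, ∀ y ∈ C, x ≠ y → inner ℝ x y ≤ 1 / 5) (hN : C.card = 16)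
include h1 h2 hN

/-- **Inner products of a `(5, 16, 1/5)` code** lie in `{1/5, -3/5}`. [cite: CohnKumar2006, Appendix A] -/
theorem inner_of_card_eq_16 {x y : EuclideanSpace ℝ (Fin 5)} (hx : x ∈ C) (hy : y ∈ C) (hxy : x ≠ y) :
    inner ℝ x y = 1 / 5 ∨ inner ℝ x y = -3 / 5 := by
  have h0 := DelsarteLP.sum_eq_zero_of_card_mul_eq (n := 5) (μ := 3 / 2) (by norm_num) (by norm_num) 3
    (fun k => match k with | 0 => 16 / 125 | 1 => 32 / 175 | 2 => 2 / 15 | 3 => 2 / 35 | _ => 0)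
    ?_ (1 / 5) ?_ C h1 h2 ?_ hx hy hxy
  · rw [hpoly] at h0
    rcases mul_eq_zero.mp h0 with h | h
    · right
      have := pow_eq_zero_iff two_ne_zero |>.mp h
      linarith
    · left; linarith
  · intro k; split <;> norm_num
  · intro t ht1 ht2
    rw [hpoly]
    exact mul_nonpos_of_nonneg_of_nonpos (by positivity) (by linarith)
  · rw [hN]
    norm_num [Finset.sum_range_succ, gegenbauerSum, gegenbauerCoeff, Finset.prod_range_succ, Nat.factorial]

/-- **Design property**: the Gegenbauer moments of orders `1, 2, 3` of a `(5, 16, 1/5)` code vanish.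
[cite: CohnKumar2006, Appendix A] -/
theorem moments_of_card_eq_16 {k : ℕ} (hk1 : 1 ≤ k) (hk2 : k ≤ 3) :
    ∑ x ∈ C, ∑ y ∈ C, gegenbauerSum ((3 / 2 : ℝ)) k (inner ℝ x y) = 0 := by
  classical
  have hinner : ∀ a b : EuclideanSpace ℝ (Fin 5), inner ℝ a b = ∑ j, a j * b j := fun a b => by
    simp [PiLp.inner_apply, mul_comm]
  have key := DelsarteLP.sum_sum_gegenbauerSum_eq_zero_of_card_mul_eq_coord (n := 5) (μ := 3 / 2)
    (by norm_num) (by norm_num) 3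
    (fun k => match k with | 0 => 16 / 125 | 1 => 32 / 175 | 2 => 2 / 15 | 3 => 2 / 35 | _ => 0)
    ?_ (1 / 5) ?_ (ι := C) (fun a j => (a : EuclideanSpace ℝ (Fin 5)) j) ?_ ?_ ?_
    (k := k) (Finset.mem_range.2 (by omega)) hk1 ?_
  · have hco : ∑ x ∈ C, ∑ y ∈ C, gegenbauerSum ((3 / 2 : ℝ)) k (inner ℝ x y) =
        ∑ a : C, ∑ b : C, gegenbauerSum ((3 / 2 : ℝ)) k
          (∑ j, (a : EuclideanSpace ℝ (Fin 5)) j * (b : EuclideanSpace ℝ (Fin 5)) j) := by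
      rw [← Finset.sum_coe_sort C]
      refine Finset.sum_congr rfl fun a _ => ?_
      rw [← Finset.sum_coe_sort C]
      exact Finset.sum_congr rfl fun b _ => by rw [hinner]
    rw [hco]
    exact key
  · intro k; split <;> norm_num
  · intro t ht1 ht2
    rw [hpoly]
    exact mul_nonpos_of_nonneg_of_nonpos (by positivity) (by linarith)
  · intro a
    rw [← EuclideanSpace.real_norm_sq_eq, h1 a a.2, one_pow]
  · intro a b hab
    have hne : (a : EuclideanSpace ℝ (Fin 5)) ≠ b := fun h => hab (Subtype.ext h)
    have h := h2 a a.2 b b.2 hne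
    rwa [hinner] at h
  · rw [Fintype.card_coe, hN]
    norm_num [Finset.sum_range_succ, gegenbauerSum, gegenbauerCoeff, Finset.prod_range_succ, Nat.factorial]
  · interval_cases k <;> norm_num

/-- Strength `1`: `Σ_{w ∈ C} ⟪u, w⟫ = 0` for every `u`. -/
theorem sum_inner_eq_zero (u : EuclideanSpace ℝ (Fin 5)) : ∑ w ∈ C, inner ℝ u w = 0 :=
  DesignIdentities.sum_inner_eq_zero (μ := 3 / 2) (by norm_num) C
    (moments_of_card_eq_16 h1 h2 hN le_rfl (by norm_num)) u

/-! ### The frame: the five points at `-3/5` from a point -/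

/-- Around every point of the code exactly `5` others are at inner product `-3/5`. -/
theorem card_filter_eq_five {x : EuclideanSpace ℝ (Fin 5)} (hx : x ∈ C) :
    (C.filter fun w => inner ℝ x w = -3 / 5).card = 5 := by
  classical
  set F : EuclideanSpace ℝ (Fin 5) → ℝ := fun w => (1 - 5 * inner ℝ x w) / 4 with hF
  have htot : ∑ w ∈ C, F w = 4 := by
    simp only [hF]
    rw [← Finset.sum_div, Finset.sum_sub_distrib, ← Finset.mul_sum, sum_inner_eq_zero h1 h2 hN x,
      sum_const, hN]
    norm_num
  have hsplit := Finset.sum_filter_add_sum_filter_not C (fun w => inner ℝ x w = -3 / 5) F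
  have hK : ∑ w ∈ C.filter (fun w => inner ℝ x w = -3 / 5), F w =
      ((C.filter fun w => inner ℝ x w = -3 / 5).card : ℝ) := by
    rw [Finset.sum_congr rfl (fun w hw => ?_), sum_const, nsmul_eq_mul, mul_one]
    rw [hF]
    simp only [(mem_filter.mp hw).2]
    norm_num
  have hrest : ∑ w ∈ C.filter (fun w => ¬ inner ℝ x w = -3 / 5), F w = -1 := by
    have hval : ∀ w ∈ C.filter (fun w => ¬ inner ℝ x w = -3 / 5), F w = if w = x then -1 else 0 := by
      intro w hw
      obtain ⟨hwC, hne⟩ := mem_filter.mp hw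
      by_cases hwx : w = x
      · rw [if_pos hwx, hwx, hF]
        simp only [real_inner_self_eq_norm_sq, h1 x hx]
        norm_num
      · rw [if_neg hwx, hF]
        rcases inner_of_card_eq_16 h1 h2 hN hx hwC (Ne.symm hwx) with h | h
        · simp only [h]; norm_num
        · exact absurd h hne
    have hxm : x ∈ C.filter (fun w => ¬ inner ℝ x w = -3 / 5) := by
      refine mem_filter.mpr ⟨hx, ?_⟩
      rw [real_inner_self_eq_norm_sq, h1 x hx]
      norm_num
    rw [Finset.sum_congr rfl hval, Finset.sum_ite_eq' _ x, if_pos hxm]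
  rw [hK, hrest] at hsplit
  have h5 : ((C.filter fun w => inner ℝ x w = -3 / 5).card : ℝ) = ((5 : ℕ) : ℝ) := by push_cast; linarith
  exact Nat.cast_injective h5

/-- Two distinct points at `-3/5` from a common point are at `1/5` from each other. -/
theorem inner_eq_fifth_of_neg {x w w' : EuclideanSpace ℝ (Fin 5)} (hx : x ∈ C) (hw : w ∈ C)
    (hw' : w' ∈ C) (hxw : inner ℝ x w = -3 / 5) (hxw' : inner ℝ x w' = -3 / 5) (hne : w ≠ w') :
    inner ℝ w w' = 1 / 5 := by
  rcases inner_of_card_eq_16 h1 h2 hN hw hw' hne with h | h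
  · exact h
  · exfalso
    have hnn : 0 ≤ ‖x + w + w'‖ ^ 2 := sq_nonneg _
    rw [← real_inner_self_eq_norm_sq] at hnn
    simp only [inner_add_left, inner_add_right, real_inner_self_eq_norm_sq, h1 x hx, h1 w hw, h1 w' hw'] at hnn
    linarith [real_inner_comm x w, real_inner_comm x w', real_inner_comm w w']

/-- **The frame.** A `(5, 16, 1/5)` code contains five points pairwise at inner product `1/5`. -/
theorem exists_frame : ∃ a : Fin 5 → EuclideanSpace ℝ (Fin 5), (∀ i, a i ∈ C) ∧
    ∀ i j, inner ℝ (a i) (a j) = if i = j then 1 else 1 / 5 := by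
  classical
  have hne : C.Nonempty := by rw [← Finset.card_pos, hN]; norm_num
  obtain ⟨x, hx⟩ := hne
  set K := C.filter fun w => inner ℝ x w = -3 / 5 with hK
  have hcard : Fintype.card K = 5 := by rw [Fintype.card_coe, card_filter_eq_five h1 h2 hN hx]
  let e : K ≃ Fin 5 := Fintype.equivFinOfCardEq hcard
  refine ⟨fun i => ((e.symm i : K) : EuclideanSpace ℝ (Fin 5)), fun i => (mem_filter.mp (e.symm i).2).1, ?_⟩
  intro i j
  by_cases hij : i = j
  · subst hij
    rw [if_pos rfl, real_inner_self_eq_norm_sq, h1 _ (mem_filter.mp (e.symm i).2).1, one_pow]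
  · rw [if_neg hij]
    have hne : ((e.symm i : K) : EuclideanSpace ℝ (Fin 5)) ≠ (e.symm j : K) := by
      intro h
      exact hij (e.symm.injective (Subtype.ext h))
    exact inner_eq_fifth_of_neg h1 h2 hN hx (mem_filter.mp (e.symm i).2).1 (mem_filter.mp (e.symm j).2).1
      (mem_filter.mp (e.symm i).2).2 (mem_filter.mp (e.symm j).2).2 hne

end config

/-! ### Index data of the family and the profile of a point -/

/-- Index set of the `16`-point family: frame vectors (`{k}`, coefficient `0`), the point `-σ/3`
(`∅`, `1/3`), and the ten points `Σ_{j ∈ T} aⱼ - (2/3)σ`, `|T| = 3` (`σ = Σ aⱼ`). -/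
abbrev Idx : Type := Fin 5 ⊕ Unit ⊕ {T : Finset (Fin 5) // T.card = 3}

/-- The subset of the frame entering the member of the family. -/
def setOf : Idx → Finset (Fin 5)
  | Sum.inl k => {k}
  | Sum.inr (Sum.inl _) => ∅
  | Sum.inr (Sum.inr T) => T.1

/-- The coefficient of `σ = Σ aⱼ` subtracted in the member of the family. -/
def coefOf : Idx → ℝ
  | Sum.inl _ => 0
  | Sum.inr (Sum.inl _) => 1 / 3
  | Sum.inr (Sum.inr _) => 2 / 3

/-- The index set has `16 = 5 + 1 + 10` elements. -/
theorem card_Idx : Fintype.card Idx = 16 := by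
  simp only [Idx, Fintype.card_sum, Fintype.card_fin, Fintype.card_unit]
  rfl

/-- `fam a T c` as a single sum of multiples of the frame. -/
private theorem fam_eq_sum {a : Fin 5 → EuclideanSpace ℝ (Fin 5)} (T : Finset (Fin 5)) (c : ℝ) :
    fam a T c = ∑ j, ((if j ∈ T then (1 : ℝ) else 0) - c) • a j := by
  classical
  simp only [fam, sub_smul, Finset.sum_sub_distrib, ite_smul, one_smul, zero_smul, Finset.sum_ite_mem,
    Finset.univ_inter, Finset.smul_sum]

section profile

variable {C : Finset (EuclideanSpace ℝ (Fin 5))} (h1 : ∀ x ∈ C, ‖x‖ = 1)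
  (h2 : ∀ x ∈ C, ∀ y ∈ C, x ≠ y → inner ℝ x y ≤ 1 / 5) (hN : C.card = 16)
  {a : Fin 5 → EuclideanSpace ℝ (Fin 5)} (ha : ∀ i, a i ∈ C)
  (hG : ∀ i j, inner ℝ (a i) (a j) = if i = j then 1 else 1 / 5)
include h1 h2 hN ha hG

/-- **Every point of the code is a member of the fixed family over the frame.** -/
theorem exists_index {z : EuclideanSpace ℝ (Fin 5)} (hz : z ∈ C) :
    ∃ x : Idx, z = fam a (setOf x) (coefOf x) := by
  classical
  by_cases hza : ∃ k, z = a k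
  · obtain ⟨k, rfl⟩ := hza
    exact ⟨Sum.inl k, (fam_singleton_zero a k).symm⟩
  push Not at hza
  have hb : ∀ k, inner ℝ z (a k) = 1 / 5 ∨ inner ℝ z (a k) = -3 / 5 := fun k =>
    inner_of_card_eq_16 h1 h2 hN hz (ha k) (hza k)
  have hcard : Fintype.card (Fin 5) = finrank ℝ (EuclideanSpace ℝ (Fin 5)) := by simp
  have hrepr := repr_formula hG (by norm_num) (by norm_num) hcard z
  have hnorm := norm_identity hG (by norm_num) (by norm_num) hcard z
  have hs1 := sum_comp_two_values (fun k => inner ℝ z (a k)) hb (fun t => t)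
  have hs2 := sum_comp_two_values (fun k => inner ℝ z (a k)) hb (fun t => t ^ 2)
  set S := univ.filter fun k => inner ℝ z (a k) = -3 / 5 with hS
  simp only [Fintype.card_fin, Nat.cast_ofNat] at hrepr hnorm hs1 hs2
  rw [h1 z hz, hs1, hs2] at hnorm
  have hsle : S.card ≤ 5 := by
    have := Finset.card_le_univ S; simpa using this
  -- the norm identity is a quadratic equation in `|S|` with roots `2` and `5`
  have hs : S.card = 2 ∨ S.card = 5 := by
    have hq : ((S.card : ℝ) - 2) * ((S.card : ℝ) - 5) = 0 := by nlinarith [hnorm]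
    rcases mul_eq_zero.mp hq with h | h
    · left; exact_mod_cast (by linarith : (S.card : ℝ) = 2)
    · right; exact_mod_cast (by linarith : (S.card : ℝ) = 5)
  -- the coefficients of the representation
  have hcoef : ∀ j, (inner ℝ z (a j) - 1 / 5 * (∑ i, inner ℝ z (a i)) / (1 + (5 - 1) * (1 / 5))) / (1 - 1 / 5)
      = (if j ∈ univ \ S then (1 : ℝ) else 0) - (8 - (S.card : ℝ)) / 9 := by
    intro j
    rw [hs1]
    by_cases hj : inner ℝ z (a j) = -3 / 5
    · have hjS : j ∈ S := mem_filter.mpr ⟨mem_univ j, hj⟩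
      rw [if_neg (fun h => (mem_sdiff.mp h).2 hjS), hj]
      ring
    · have hjS : j ∉ S := fun h => hj (mem_filter.mp h).2
      rw [if_pos (mem_sdiff.mpr ⟨mem_univ j, hjS⟩), (hb j).resolve_right hj]
      ring
  have hz' : z = fam a (univ \ S) ((8 - (S.card : ℝ)) / 9) := by
    rw [fam_eq_sum]
    conv_lhs => rw [hrepr]
    exact Finset.sum_congr rfl fun j _ => by rw [hcoef j]
  rcases hs with hs | hs
  · -- ten points: `T = Sᶜ`, `|T| = 3`, coefficient `2/3`
    have hT : (univ \ S).card = 3 := by rw [Finset.card_univ_sdiff, Fintype.card_fin, hs]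
    refine ⟨Sum.inr (Sum.inr ⟨univ \ S, hT⟩), ?_⟩
    rw [hz', setOf, coefOf, hs]
    norm_num
  · -- the point `-σ/3`: `S = univ`, `T = ∅`, coefficient `1/3`
    have hSu : S = univ := Finset.eq_univ_of_card S (by rw [hs, Fintype.card_fin])
    refine ⟨Sum.inr (Sum.inl ()), ?_⟩
    rw [hz', setOf, coefOf, hs, hSu, sdiff_self]
    norm_num

/-- **The code is the image of the fixed family over the frame.** -/
theorem eq_image : C = univ.image fun x : Idx => fam a (setOf x) (coefOf x) := by
  classical
  exact eq_image_of_forall_exists C _ (fun z hz => exists_index h1 h2 hN ha hG hz) (by rw [card_Idx, hN])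

end profile

/-! ### Uniqueness -/

/-- **Uniqueness of the `(5, 16, 1/5)` code.** Any two `16`-point codes in `ℝ⁵` with pairwise inner products
`≤ 1/5` are isometric. [cite: CohnKumar2006, Appendix A] -/
theorem isometric {C C' : Finset (EuclideanSpace ℝ (Fin 5))} (h1 : ∀ x ∈ C, ‖x‖ = 1)
    (h2 : ∀ x ∈ C, ∀ y ∈ C, x ≠ y → inner ℝ x y ≤ 1 / 5) (hN : C.card = 16) (h1' : ∀ x ∈ C', ‖x‖ = 1)
    (h2' : ∀ x ∈ C', ∀ y ∈ C', x ≠ y → inner ℝ x y ≤ 1 / 5) (hN' : C'.card = 16) :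
    ∃ Ψ : EuclideanSpace ℝ (Fin 5) ≃ₗᵢ[ℝ] EuclideanSpace ℝ (Fin 5), C' = C.image Ψ := by
  classical
  obtain ⟨a, ha, hG⟩ := exists_frame h1 h2 hN
  obtain ⟨a', ha', hG'⟩ := exists_frame h1' h2' hN'
  exact isometric_of_frames setOf coefOf hG hG' (eq_image h1 h2 hN ha hG) (eq_image h1' h2' hN' ha' hG')

/-- **Every `(5, 16, 1/5)` code is an isometric image of `Config.Dim5Card16.pts`** (the normalised even sign
vectors of `(±1)⁵`). [cite: CohnKumar2006, Appendix A] -/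
theorem isometric_pts {C : Finset (EuclideanSpace ℝ (Fin 5))} (h1 : ∀ x ∈ C, ‖x‖ = 1)
    (h2 : ∀ x ∈ C, ∀ y ∈ C, x ≠ y → inner ℝ x y ≤ 1 / 5) (hN : C.card = 16) :
    ∃ Ψ : EuclideanSpace ℝ (Fin 5) ≃ₗᵢ[ℝ] EuclideanSpace ℝ (Fin 5), C = Dim5Card16.pts.image Ψ := by
  have hq : 0 < (Int.castRingHom ℝ) (5 : ℤ) := by simp
  have hn1 : ∀ x ∈ Dim5Card16.pts, ‖x‖ = 1 := norm_eq_one hq Dim5Card16.shape_vecs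
  exact isometric hn1 Dim5Card16.inner_pts_le Dim5Card16.card_pts h1 h2 hN

/-- **Ground-state form**: every `16`-point configuration on `S⁴` attaining the universal lower bound of the
`(1+t)^k`-energy for one `k ≥ 4` is an isometric image of `Config.Dim5Card16.pts` — the `D₅` half-cube is the
unique ground state (Cohn–Kumar Thm 1.2, uniqueness for the row `(5, 16)`).
[cite: CohnKumar2006, Theorem 1.2 and Appendix A] -/
theorem isometric_pts_of_ckPow_energy_eq {C : Finset (EuclideanSpace ℝ (Fin 5))} (h1 : ∀ x ∈ C, ‖x‖ = 1)
    (hN : C.card = 16) (k : ℕ) (hk : 4 ≤ k)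
    (hE : ∑ x ∈ C, ∑ y ∈ C.erase x, (1 + inner ℝ x y) ^ k =
      (16 : ℝ) * (5 * (1 + (-3 / 5 : ℝ)) ^ k + 10 * (1 + (1 / 5 : ℝ)) ^ k)) :
    ∃ Ψ : EuclideanSpace ℝ (Fin 5) ≃ₗᵢ[ℝ] EuclideanSpace ℝ (Fin 5), C = Dim5Card16.pts.image Ψ :=
  isometric_pts h1 (Dim5Card16EnergyRigidity.inner_le_of_ckPow_energy_eq h1 hN k hk hE) hN

end Summit.Ventures.PackingBounds.Config.Dim5Card16Unique

end
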